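import Summits.BirchSwinnertonDyer.BirchSwinnertonDyer.Theorems.ByReductionTypeAtTwoAdditiveReducibleRestSiblingInstancesA
import Summits.BirchSwinnertonDyer.Rank1Residual.X5.TwoAdicImageCertificates
import Literature.NumberTheory.EllipticCurves.BinaryQuarticStabilizerTorsion
import HarnessLib

/-!
# K4 crux `AdditiveRankZeroAtTwo` (19098), children C3″ (22617) / C2″ (22616): the TORSION SLOTS of this seat's instance stamps at the
# `t = 1` rows, DECIDED BY THE KERNEL — `#E(ℚ)[2^(j+1)] = 2` for every `j` at the eleven curves with Cremona torsion structure `[2]`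
# (27672d1, 27672d2; the K2 reps 31200bc3, 243360bg2, 290400di2, 487200v2, 496320w4; the minimal members 120888c1, 275520o1,
# 265200dr1, 281456h1): one rational root of the `2`-division cubic + the HALVING CRITERION at the rational `2`-torsion point

Cell `bsd-2adic`, seat `bsd-2adic-k4-w2` GEN 2 (prover, explicit unit, no kit); `--supports stmt-BirchSwinnertonDyer-22616 --as helper`
(serves 22617 equally); sequel of this GEN's instance stamps p662085 (`…LowerHalfClass27672d`), p662759 / p663627 / p663762
(`…ReducibleRestSiblingInstances{A,B,C}`), p663908 / `…ReducibleRestMemberInstances{A,B}`, whose theorems DISPLAY the torsion counts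
`#E(ℚ)[2] = 2`, `#E(ℚ)[4] = 2`, `#E(ℚ)[8] = 2` of these curves as hypotheses `ht`, `ht₁`, `ht₂` (read from Cremona's torsion structure
`[2]`). This file DISCHARGES those hypotheses by name (`card_torsionBy_two_pow_succ_<label> 0 / 1 / 2`), so that after it the only
undecided inputs of the eleven stamps are the Selmer counts (instrument tier), `#Ш_an` and `r_an` (analytic record) and the published
facts taken by name. The two `ℤ/4`-curves of the tables (`303576s3`, `362376g1`) are not treated (their point of order `2` IS halvable).
§2 performs the substitution once (`missingUpperBoundAt_two_31200bc1_of_31200bc3_selmerOnly`). THEOREMS ONLY (ellipticity of each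
literal curve is re-derived inline inside the proofs, not restated as a declaration).

HONEST FRAMING: kernel theorems about explicit curves; nothing booked; the `∀`-items C2″/C3″ stay OPEN; BSD is not proved by any of this.
METHOD (§0, generic over `ℚ`). (i) `natCard_torsionBy_two_of_unique_root`: if `4x³ + b₂x² + 2b₄x + b₆ = 4(x − e)(x² + Ax + B)` with
`A² − 4B` not a rational square, the `2`-division cubic has the single rational root `e`, so `#E(ℚ)[2] = 2` (tree
`WeierstrassCurve.natCard_torsionBy_two_eq`, Silverman III.2.3 (d)). (ii) `exists_of_two_nsmul_eq` — the HALVING CRITERION for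
`a₁ = a₃ = 0`: if `2P = (e, 0)` with `P = (x, y)` rational, then `u = x − e` has `u² = t := f′(e) = 3e² + 2a₂e + a₄` and
`y² = t(2u + α)`, `α = 3e + a₂` — from Mathlib's duplication formulas (`slope_of_Y_ne`, `addX`, `add_self_of_Y_ne`) and the identity
`f′(x)² − 4(2x + e + a₂)f(x) = ((x − e)² − f′(e))²` (valid when `f(e) = 0`), closed by `linear_combination`. Hence
`no_halving_of_not_isSquare` (`t` not a square) and `no_halving_of_certificates` (`t = c²` but `t(α ± 2c)` not squares).
(iii) `natCard_torsionBy_two_pow_succ_eq_two`: `#E(ℚ)[2] = 2`, `T ≠ O`, `2T = O`, `T ∉ 2E(ℚ)` ⟹ `#E(ℚ)[2^(j+1)] = 2` for all `j`.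
Per curve the non-squares are certified non-residues modulo a small prime (`decide`) or negative; the factorisation by `norm_num; ring`.
References: [SilvermanAEC2009] III.2.3 (d), VIII.7; [Knapp1993] Thm. 4.2 (halving criterion); [CremonaAlgorithms1997] Table 1.
-/

set_option autoImplicit false
-- the Theorems namespace of this sub repeats the summit name by design (D-0017 nested layout)
set_option linter.dupNamespace false

noncomputable section

open scoped Classical

open WeierstrassCurve Literature.NumberTheory.EllipticCurves
  Literature.NumberTheory.EllipticCurves.Rank1Residual Literature.NumberTheory.EllipticCurves.Rank1Residual.Typed
  Summit.BirchSwinnertonDyer.Rank1Residual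
  Summit.BirchSwinnertonDyer.Rank1Residual.X5.O1

namespace Summit.BirchSwinnertonDyer.BirchSwinnertonDyer.Theorems.AddPotGoodInstances

/-! ## §0 Generic: one rational root ⟹ `#E(K)[2] = 2`; the halving criterion `2P = (e, 0) ⟹ (x(P) − e)² = f′(e)`; torsion slots at a `t = 1` row -/

/-- **Exactly one rational root of the `2`-division cubic gives `#E(ℚ)[2] = 2`**: if
`4x³ + b₂x² + 2b₄x + b₆ = 4(x − e)(x² + Ax + B)` with `A² − 4B` not a rational square, the root set of the `2`-division cubic is `{e}`,
so `#E(ℚ)[2] = 1 + 1` (tree `WeierstrassCurve.natCard_torsionBy_two_eq`, stated for a general field; the last step only aligns Mathlib's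
two `DecidableEq ℚ` instances). [cite: SilvermanAEC2009, III.2.3 (d)] -/
theorem natCard_torsionBy_two_of_unique_root (W : WeierstrassCurve ℚ) [W.IsElliptic] (e A B : ℚ) (hAB : ¬ IsSquare (A ^ 2 - 4 * B))
    (hf : ∀ x : ℚ, 4 * x ^ 3 + W.b₂ * x ^ 2 + 2 * W.b₄ * x + W.b₆ = 4 * (x - e) * (x ^ 2 + A * x + B)) :
    Nat.card (AddSubgroup.torsionBy W.toAffine.Point 2) = 2 ^ 1 := by
  have hq : ∀ x : ℚ, x ^ 2 + A * x + B ≠ 0 := by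
    intro x hx
    apply hAB
    exact ⟨2 * x + A, by linear_combination (-4 : ℚ) * hx⟩
  have hroots : {x : ℚ | W.twoTorsionPolynomial.toPoly.IsRoot x} = {e} := by
    ext x
    simp only [Set.mem_setOf_eq, Set.mem_singleton_iff, twoTorsionPolynomial, Cubic.toPoly, Polynomial.IsRoot.def,
      Polynomial.eval_add, Polynomial.eval_mul, Polynomial.eval_C, Polynomial.eval_pow, Polynomial.eval_X]
    have key := hf x
    constructor
    · intro h
      have h0 : 4 * (x - e) * (x ^ 2 + A * x + B) = 0 := by rw [← key]; linear_combination h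
      rcases mul_eq_zero.mp h0 with h0 | h0
      · rcases mul_eq_zero.mp h0 with h0 | h0
        · norm_num at h0
        · exact sub_eq_zero.mp h0
      · exact absurd h0 (hq x)
    · rintro rfl
      linear_combination key
  have h := WeierstrassCurve.natCard_torsionBy_two_eq W (show (2 : ℚ) ≠ 0 by norm_num)
  rw [hroots, Set.ncard_singleton, show (1 : ℕ) + 1 = 2 ^ 1 from rfl] at h
  convert h using 4; convert Iff.rfl

/-- **The halving criterion at a rational `2`-torsion point** (`a₁ = a₃ = 0`): if `2P = (e, 0)` for a rational point `P = (x, y)`,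
then `u := x − e` satisfies `u² = t := 3e² + 2a₂e + a₄ = f′(e)` and `y² = t·(2u + α)`, `α := 3e + a₂`. Indeed Mathlib's duplication
gives `x(2P) = ℓ² − a₂ − 2x` and `2ℓy = f′(x)`, while `f′(x)² − 4(2x + e + a₂)·f(x) = ((x − e)² − f′(e))²` when `f(e) = 0`, and
`f(x) = u³ + αu² + tu`. So `(e, 0) ∈ 2E(ℚ)` needs `t = c²` AND one of `t(α ± 2c)` to be a rational square. [cite: SilvermanAEC2009, III.2.3 (d)] -/
theorem exists_of_two_nsmul_eq (W : WeierstrassCurve ℚ) [W.IsElliptic] (ha₁ : W.a₁ = 0) (ha₃ : W.a₃ = 0) {e t α : ℚ}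
    (ht : 3 * e ^ 2 + 2 * W.a₂ * e + W.a₄ = t) (hα : 3 * e + W.a₂ = α)
    {he : W.toAffine.Nonsingular e 0} {P : W.toAffine.Point} (h2 : (2 : ℕ) • P = Affine.Point.some e 0 he) :
    ∃ u : ℚ, u ^ 2 = t ∧ IsSquare (t * (2 * u + α)) := by
  have hfe : e ^ 3 + W.a₂ * e ^ 2 + W.a₄ * e + W.a₆ = 0 := by
    have := (Affine.equation_iff e 0).mp he.left
    rw [ha₁, ha₃] at this
    linear_combination -this
  rcases P with _ | ⟨x, y, hP⟩
  · exact absurd (h2.symm.trans (nsmul_zero 2)) (Affine.Point.some_ne_zero he)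
  have hnegY : ∀ u v : ℚ, W.toAffine.negY u v = -v := by
    intro u v; rw [Affine.negY, ha₁, ha₃]; ring
  have hPeq : y ^ 2 = x ^ 3 + W.a₂ * x ^ 2 + W.a₄ * x + W.a₆ := by
    have := (Affine.equation_iff x y).mp hP.left
    rw [ha₁, ha₃] at this
    linear_combination this
  have hy : y ≠ W.toAffine.negY x y := by
    intro hy
    have h0 : (2 : ℕ) • (Affine.Point.some x y hP) = 0 := by rw [two_nsmul]; exact Affine.Point.add_self_of_Y_eq hy
    rw [h0] at h2
    exact Affine.Point.some_ne_zero he h2.symm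
  have hℓval : W.toAffine.slope x x y y * (2 * y) = 3 * x ^ 2 + 2 * W.a₂ * x + W.a₄ := by
    have hy0 : y ≠ 0 := by intro h0; apply hy; rw [hnegY, h0, neg_zero]
    rw [W.toAffine.slope_of_Y_ne rfl hy, hnegY, ha₁]
    field_simp
    ring
  have hx₂val : W.toAffine.addX x x (W.toAffine.slope x x y y) = W.toAffine.slope x x y y ^ 2 - W.a₂ - 2 * x := by
    rw [Affine.addX, ha₁]; ring
  have hsum : (2 : ℕ) • (Affine.Point.some x y hP) =
      Affine.Point.some _ _ (Affine.nonsingular_add hP hP fun hxy => hy hxy.right) := by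
    rw [two_nsmul]; exact Affine.Point.add_self_of_Y_ne hy
  rw [hsum] at h2
  have hxe : W.toAffine.addX x x (W.toAffine.slope x x y y) = e := (Affine.Point.some.injEq _ _ _ _ _ _ |>.mp h2).1
  generalize W.toAffine.slope x x y y = ℓ at hℓval hx₂val hxe
  rw [hx₂val] at hxe
  have hsq : ((x - e) ^ 2 - (3 * e ^ 2 + 2 * W.a₂ * e + W.a₄)) ^ 2 = 0 := by
    linear_combination (-(3 * x ^ 2 + 2 * W.a₂ * x + W.a₄ + 2 * ℓ * y)) * hℓval + (4 * ℓ ^ 2) * hPeq +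
      (4 * (x ^ 3 + W.a₂ * x ^ 2 + W.a₄ * x + W.a₆)) * hxe + (4 * (2 * x + e + W.a₂)) * hfe
  have hu : (x - e) ^ 2 = t := by
    rw [← ht]; exact sub_eq_zero.mp (pow_eq_zero_iff (n := 2) (by norm_num) |>.mp hsq)
  refine ⟨x - e, hu, y, ?_⟩
  rw [← ht, ← hα]
  rw [← ht] at hu
  linear_combination -hPeq - ((x - e) + (3 * e + W.a₂)) * hu - hfe

/-- **No halving when `f′(e)` is not a square**: with the data of `exists_of_two_nsmul_eq`, if `t` is not a rational square then no
rational `P` has `2P = (e, 0)`. [cite: SilvermanAEC2009, III.2.3 (d)] -/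
theorem no_halving_of_not_isSquare (W : WeierstrassCurve ℚ) [W.IsElliptic] (ha₁ : W.a₁ = 0) (ha₃ : W.a₃ = 0) {e t α : ℚ}
    (ht : 3 * e ^ 2 + 2 * W.a₂ * e + W.a₄ = t) (hα : 3 * e + W.a₂ = α) (hnt : ¬ IsSquare t)
    {he : W.toAffine.Nonsingular e 0} : ∀ P : W.toAffine.Point, (2 : ℕ) • P ≠ Affine.Point.some e 0 he := by
  intro P hP
  obtain ⟨u, hu, -⟩ := exists_of_two_nsmul_eq W ha₁ ha₃ ht hα hP
  exact hnt ⟨u, by rw [← hu]; ring⟩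

/-- **No halving by two non-residue certificates**: with the data of `exists_of_two_nsmul_eq` and `t = c²`, if neither `t(2c + α)` nor
`t(−2c + α)` is a rational square then no rational `P` has `2P = (e, 0)`. [cite: SilvermanAEC2009, III.2.3 (d)] -/
theorem no_halving_of_certificates (W : WeierstrassCurve ℚ) [W.IsElliptic] (ha₁ : W.a₁ = 0) (ha₃ : W.a₃ = 0) {e t α c : ℚ}
    (ht : 3 * e ^ 2 + 2 * W.a₂ * e + W.a₄ = t) (hα : 3 * e + W.a₂ = α) (hc : c ^ 2 = t)
    (hplus : ¬ IsSquare (t * (2 * c + α))) (hminus : ¬ IsSquare (t * (2 * -c + α)))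
    {he : W.toAffine.Nonsingular e 0} : ∀ P : W.toAffine.Point, (2 : ℕ) • P ≠ Affine.Point.some e 0 he := by
  intro P hP
  obtain ⟨u, hu, hsq⟩ := exists_of_two_nsmul_eq W ha₁ ha₃ ht hα hP
  rcases sq_eq_sq_iff_eq_or_eq_neg.mp (hu.trans hc.symm) with rfl | rfl
  · exact hplus hsq
  · exact hminus hsq

/-- **Torsion slots at a `t = 1` row**: if `#E(ℚ)[2] = 2`, `T ≠ O` with `2T = O`, and no rational `P` has `2P = T`, then `#E(ℚ)[2^(j+1)] = 2`
for every `j` (`E(ℚ)[2] = {O, T}`; a point killed by `2^(j+2)` has `2^(j+1)`-multiple… inductively its double lies in `E(ℚ)[2]`, and it is not `T`).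
The TORSION SLOTS `#E(ℚ)[4] = #E(ℚ)[8] = 2` of the descent-count roads (p652544 / p652085) at a `t = 1` row, decided. [folklore] -/
theorem natCard_torsionBy_two_pow_succ_eq_two (W : WeierstrassCurve ℚ) [W.IsElliptic]
    (h2 : Nat.card (AddSubgroup.torsionBy W.toAffine.Point 2) = 2 ^ 1) {T : W.toAffine.Point} (hT0 : T ≠ 0)
    (hT2 : (2 : ℕ) • T = 0) (hno : ∀ P : W.toAffine.Point, (2 : ℕ) • P ≠ T) (j : ℕ) :
    Nat.card (AddSubgroup.torsionBy W.toAffine.Point ((2 ^ (j + 1) : ℕ) : ℤ)) = 2 ^ 1 := by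
  have hmem : ∀ Q : W.toAffine.Point, Q ∈ AddSubgroup.torsionBy W.toAffine.Point 2 ↔ (2 : ℕ) • Q = 0 :=
    fun Q ↦ AddSubgroup.torsionBy.nsmul_iff (n := 2)
  have htwo : ∀ Q : W.toAffine.Point, (2 : ℕ) • Q = 0 → Q = 0 ∨ Q = T := by
    intro Q hQ
    by_contra h
    obtain ⟨hQ0, hQT⟩ := not_or.mp h
    obtain ⟨y, -, hy⟩ := (Nat.card_eq_two_iff'
      (⟨0, AddSubgroup.zero_mem _⟩ : AddSubgroup.torsionBy W.toAffine.Point 2)).mp (by rw [h2, pow_one])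
    have hyQ := hy ⟨Q, (hmem Q).mpr hQ⟩ (fun hq ↦ hQ0 (congrArg Subtype.val hq))
    have hyT := hy ⟨T, (hmem T).mpr hT2⟩ (fun hq ↦ hT0 (congrArg Subtype.val hq))
    exact hQT (congrArg Subtype.val (hyQ.trans hyT.symm))
  have hk : ∀ (k : ℕ) (Q : W.toAffine.Point), 2 ^ (k + 1) • Q = 0 → (2 : ℕ) • Q = 0 := by
    intro k
    induction k with
    | zero => intro Q hQ; simpa using hQ
    | succ k ih =>
        intro Q hQ
        have h' : 2 ^ (k + 1) • ((2 : ℕ) • Q) = 0 := by rw [smul_smul, ← pow_succ]; exact hQ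
        rcases htwo _ (ih _ h') with h0 | hT'
        · exact h0
        · exact absurd hT' (hno Q)
  have heq : AddSubgroup.torsionBy W.toAffine.Point ((2 ^ (j + 1) : ℕ) : ℤ) = AddSubgroup.torsionBy W.toAffine.Point 2 := by
    ext Q
    rw [hmem Q]
    constructor
    · intro h
      exact hk j Q ((AddSubgroup.torsionBy.nsmul_iff (n := 2 ^ (j + 1))).mp (by exact_mod_cast h))
    · intro h
      have h' : 2 ^ (j + 1) • Q = 0 := by rw [pow_succ, ← smul_smul, h, nsmul_zero]
      exact_mod_cast (AddSubgroup.torsionBy.nsmul_iff (n := 2 ^ (j + 1))).mpr h'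
  rw [heq, h2]

/-! ## §1 The eleven `[2]`-curves of this seat's instance stamps -/

/-- **Torsion slots of `27672d1`, decided** (`#E(ℚ)[2^(j+1)] = 2`; Cremona `[2]`): cubic `4(x − e)(x² + Ax + B)`, `(e, A, B) = (-13050, -13051, -340619994)`,
`A² − 4B = 1532808577` non-square ⇒ `#E(ℚ)[2] = 2`; `T = (-13050, 0)` not halvable: `f′(e) = -1944` is not a rational square. [cite: SilvermanAEC2009, III.2.3 (d)] -/
theorem card_torsionBy_two_pow_succ_27672d1 (j : ℕ) :
    Nat.card (AddSubgroup.torsionBy (⟨0, -1, 0, -510935544, -4445090921700⟩ : WeierstrassCurve ℚ).toAffine.Point ((2 ^ (j + 1) : ℕ) : ℤ)) = 2 ^ 1 := by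
  haveI : (⟨0, -1, 0, -510935544, -4445090921700⟩ : WeierstrassCurve ℚ).IsElliptic := ⟨by
    rw [isUnit_iff_ne_zero]
    norm_num [WeierstrassCurve.Δ, WeierstrassCurve.b₂, WeierstrassCurve.b₄, WeierstrassCurve.b₆, WeierstrassCurve.b₈]⟩
  have hns : (⟨0, -1, 0, -510935544, -4445090921700⟩ : WeierstrassCurve ℚ).toAffine.Nonsingular (-13050) 0 :=
    (WeierstrassCurve.Affine.equation_iff_nonsingular).mp (by rw [WeierstrassCurve.Affine.equation_iff]; norm_num)
  refine natCard_torsionBy_two_pow_succ_eq_two _ ?_ (Affine.Point.some_ne_zero hns) ?_ ?_ j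
  · exact natCard_torsionBy_two_of_unique_root _ (-13050) (-13051) (-340619994) (by rw [show ((-13051) : ℚ) ^ 2 - 4 * (-340619994) = ((1532808577 : ℤ) : ℚ) by norm_num]; exact not_isSquare_intCast_of_forall_mul_self_ne (ℓ := 5) (by decide))
      (by intro x; norm_num [WeierstrassCurve.b₂, WeierstrassCurve.b₄, WeierstrassCurve.b₆]; ring)
  · rw [two_nsmul]; exact Affine.Point.add_self_of_Y_eq (by norm_num [WeierstrassCurve.Affine.negY])
  · exact no_halving_of_not_isSquare _ rfl rfl (e := (-13050)) (t := (-1944)) (α := (-39151)) (by norm_num) (by norm_num)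
      (by intro h; have h' := h.nonneg; norm_num at h')

/-- **Torsion slots of `27672d2`, decided** (`#E(ℚ)[2^(j+1)] = 2`; Cremona `[2]`): cubic `4(x − e)(x² + Ax + B)`, `(e, A, B) = (26101, 26100, 170310276)`,
`A² − 4B = -31104` non-square ⇒ `#E(ℚ)[2] = 2`; `T = (26101, 0)` not halvable: `f′(e) = 1532808577` is not a rational square. [cite: SilvermanAEC2009, III.2.3 (d)] -/
theorem card_torsionBy_two_pow_succ_27672d2 (j : ℕ) :
    Nat.card (AddSubgroup.torsionBy (⟨0, -1, 0, -510925824, -4445268513876⟩ : WeierstrassCurve ℚ).toAffine.Point ((2 ^ (j + 1) : ℕ) : ℤ)) = 2 ^ 1 := by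
  haveI : (⟨0, -1, 0, -510925824, -4445268513876⟩ : WeierstrassCurve ℚ).IsElliptic := ⟨by
    rw [isUnit_iff_ne_zero]
    norm_num [WeierstrassCurve.Δ, WeierstrassCurve.b₂, WeierstrassCurve.b₄, WeierstrassCurve.b₆, WeierstrassCurve.b₈]⟩
  have hns : (⟨0, -1, 0, -510925824, -4445268513876⟩ : WeierstrassCurve ℚ).toAffine.Nonsingular 26101 0 :=
    (WeierstrassCurve.Affine.equation_iff_nonsingular).mp (by rw [WeierstrassCurve.Affine.equation_iff]; norm_num)
  refine natCard_torsionBy_two_pow_succ_eq_two _ ?_ (Affine.Point.some_ne_zero hns) ?_ ?_ j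
  · exact natCard_torsionBy_two_of_unique_root _ 26101 26100 170310276 (by intro h; have h' := h.nonneg; norm_num at h')
      (by intro x; norm_num [WeierstrassCurve.b₂, WeierstrassCurve.b₄, WeierstrassCurve.b₆]; ring)
  · rw [two_nsmul]; exact Affine.Point.add_self_of_Y_eq (by norm_num [WeierstrassCurve.Affine.negY])
  · exact no_halving_of_not_isSquare _ rfl rfl (e := 26101) (t := 1532808577) (α := 78302) (by norm_num) (by norm_num)
      (by rw [show (1532808577 : ℚ) = ((1532808577 : ℤ) : ℚ) by norm_num]; exact not_isSquare_intCast_of_forall_mul_self_ne (ℓ := 5) (by decide))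

/-- **Torsion slots of `31200bc3`, decided** (`#E(ℚ)[2^(j+1)] = 2`; Cremona `[2]`): cubic `4(x − e)(x² + Ax + B)`, `(e, A, B) = (7357, 7356, 11330684)`,
`A² − 4B = 8788000` non-square ⇒ `#E(ℚ)[2] = 2`; `T = (7357, 0)` not halvable: `f′(e) = 119574225 = 10935²`, but `f′(e)·(3e + a₂ ± 2·10935) = 5254091446500, 23914845000` are not rational squares. [cite: SilvermanAEC2009, III.2.3 (d)] -/
theorem card_torsionBy_two_pow_succ_31200bc3 (j : ℕ) :
    Nat.card (AddSubgroup.torsionBy (⟨0, -1, 0, -42787408, -83359842188⟩ : WeierstrassCurve ℚ).toAffine.Point ((2 ^ (j + 1) : ℕ) : ℤ)) = 2 ^ 1 := by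
  haveI : (⟨0, -1, 0, -42787408, -83359842188⟩ : WeierstrassCurve ℚ).IsElliptic := ⟨by
    rw [isUnit_iff_ne_zero]
    norm_num [WeierstrassCurve.Δ, WeierstrassCurve.b₂, WeierstrassCurve.b₄, WeierstrassCurve.b₆, WeierstrassCurve.b₈]⟩
  have hns : (⟨0, -1, 0, -42787408, -83359842188⟩ : WeierstrassCurve ℚ).toAffine.Nonsingular 7357 0 :=
    (WeierstrassCurve.Affine.equation_iff_nonsingular).mp (by rw [WeierstrassCurve.Affine.equation_iff]; norm_num)
  refine natCard_torsionBy_two_pow_succ_eq_two _ ?_ (Affine.Point.some_ne_zero hns) ?_ ?_ j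
  · exact natCard_torsionBy_two_of_unique_root _ 7357 7356 11330684 (by rw [show (7356 : ℚ) ^ 2 - 4 * 11330684 = ((8788000 : ℤ) : ℚ) by norm_num]; exact not_isSquare_intCast_of_forall_mul_self_ne (ℓ := 17) (by decide))
      (by intro x; norm_num [WeierstrassCurve.b₂, WeierstrassCurve.b₄, WeierstrassCurve.b₆]; ring)
  · rw [two_nsmul]; exact Affine.Point.add_self_of_Y_eq (by norm_num [WeierstrassCurve.Affine.negY])
  · exact no_halving_of_certificates _ rfl rfl (e := 7357) (t := 119574225) (α := 22070) (c := 10935) (by norm_num) (by norm_num)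
      (by norm_num) (by rw [show (119574225 : ℚ) * (2 * 10935 + 22070) = ((5254091446500 : ℤ) : ℚ) by norm_num]; exact not_isSquare_intCast_of_forall_mul_self_ne (ℓ := 11) (by decide))
      (by rw [show (119574225 : ℚ) * (2 * -10935 + 22070) = ((23914845000 : ℤ) : ℚ) by norm_num]; exact not_isSquare_intCast_of_forall_mul_self_ne (ℓ := 11) (by decide))

/-- **Torsion slots of `243360bg2`, decided** (`#E(ℚ)[2^(j+1)] = 2`; Cremona `[2]`): cubic `4(x − e)(x² + Ax + B)`, `(e, A, B) = (57382, 57382, 689508001)`,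
`A² − 4B = 534661920` non-square ⇒ `#E(ℚ)[2] = 2`; `T = (57382, 0)` not halvable: `f′(e) = 7274895849 = 85293²`, but `f′(e)·(3e + a₂ ± 2·85293) = 2493339604119468, 11348837524440` are not rational squares. [cite: SilvermanAEC2009, III.2.3 (d)] -/
theorem card_torsionBy_two_pow_succ_243360bg2 (j : ℕ) :
    Nat.card (AddSubgroup.torsionBy (⟨0, 0, 0, -2603185923, -39565348113382⟩ : WeierstrassCurve ℚ).toAffine.Point ((2 ^ (j + 1) : ℕ) : ℤ)) = 2 ^ 1 := by
  haveI : (⟨0, 0, 0, -2603185923, -39565348113382⟩ : WeierstrassCurve ℚ).IsElliptic := ⟨by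
    rw [isUnit_iff_ne_zero]
    norm_num [WeierstrassCurve.Δ, WeierstrassCurve.b₂, WeierstrassCurve.b₄, WeierstrassCurve.b₆, WeierstrassCurve.b₈]⟩
  have hns : (⟨0, 0, 0, -2603185923, -39565348113382⟩ : WeierstrassCurve ℚ).toAffine.Nonsingular 57382 0 :=
    (WeierstrassCurve.Affine.equation_iff_nonsingular).mp (by rw [WeierstrassCurve.Affine.equation_iff]; norm_num)
  refine natCard_torsionBy_two_pow_succ_eq_two _ ?_ (Affine.Point.some_ne_zero hns) ?_ ?_ j
  · exact natCard_torsionBy_two_of_unique_root _ 57382 57382 689508001 (by rw [show (57382 : ℚ) ^ 2 - 4 * 689508001 = ((534661920 : ℤ) : ℚ) by norm_num]; exact not_isSquare_intCast_of_forall_mul_self_ne (ℓ := 17) (by decide))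
      (by intro x; norm_num [WeierstrassCurve.b₂, WeierstrassCurve.b₄, WeierstrassCurve.b₆]; ring)
  · rw [two_nsmul]; exact Affine.Point.add_self_of_Y_eq (by norm_num [WeierstrassCurve.Affine.negY])
  · exact no_halving_of_certificates _ rfl rfl (e := 57382) (t := 7274895849) (α := 172146) (c := 85293) (by norm_num) (by norm_num)
      (by norm_num) (by rw [show (7274895849 : ℚ) * (2 * 85293 + 172146) = ((2493339604119468 : ℤ) : ℚ) by norm_num]; exact not_isSquare_intCast_of_forall_mul_self_ne (ℓ := 5) (by decide))
      (by rw [show (7274895849 : ℚ) * (2 * -85293 + 172146) = ((11348837524440 : ℤ) : ℚ) by norm_num]; exact not_isSquare_intCast_of_forall_mul_self_ne (ℓ := 7) (by decide))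

/-- **Torsion slots of `290400di2`, decided** (`#E(ℚ)[2^(j+1)] = 2`; Cremona `[2]`): cubic `4(x − e)(x² + Ax + B)`, `(e, A, B) = (8947, 8946, 17067429)`,
`A² − 4B = 11761200` non-square ⇒ `#E(ℚ)[2] = 2`; `T = (8947, 0)` not halvable: `f′(e) = 177156100 = 13310²`, but `f′(e)·(3e + a₂ ± 2·13310) = 9470765106000, 38974342000` are not rational squares. [cite: SilvermanAEC2009, III.2.3 (d)] -/
theorem card_torsionBy_two_pow_succ_290400di2 (j : ℕ) :
    Nat.card (AddSubgroup.torsionBy (⟨0, -1, 0, -62972433, -152702287263⟩ : WeierstrassCurve ℚ).toAffine.Point ((2 ^ (j + 1) : ℕ) : ℤ)) = 2 ^ 1 := by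
  haveI : (⟨0, -1, 0, -62972433, -152702287263⟩ : WeierstrassCurve ℚ).IsElliptic := ⟨by
    rw [isUnit_iff_ne_zero]
    norm_num [WeierstrassCurve.Δ, WeierstrassCurve.b₂, WeierstrassCurve.b₄, WeierstrassCurve.b₆, WeierstrassCurve.b₈]⟩
  have hns : (⟨0, -1, 0, -62972433, -152702287263⟩ : WeierstrassCurve ℚ).toAffine.Nonsingular 8947 0 :=
    (WeierstrassCurve.Affine.equation_iff_nonsingular).mp (by rw [WeierstrassCurve.Affine.equation_iff]; norm_num)
  refine natCard_torsionBy_two_pow_succ_eq_two _ ?_ (Affine.Point.some_ne_zero hns) ?_ ?_ j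
  · exact natCard_torsionBy_two_of_unique_root _ 8947 8946 17067429 (by rw [show (8946 : ℚ) ^ 2 - 4 * 17067429 = ((11761200 : ℤ) : ℚ) by norm_num]; exact not_isSquare_intCast_of_forall_mul_self_ne (ℓ := 7) (by decide))
      (by intro x; norm_num [WeierstrassCurve.b₂, WeierstrassCurve.b₄, WeierstrassCurve.b₆]; ring)
  · rw [two_nsmul]; exact Affine.Point.add_self_of_Y_eq (by norm_num [WeierstrassCurve.Affine.negY])
  · exact no_halving_of_certificates _ rfl rfl (e := 8947) (t := 177156100) (α := 26840) (c := 13310) (by norm_num) (by norm_num)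
      (by norm_num) (by rw [show (177156100 : ℚ) * (2 * 13310 + 26840) = ((9470765106000 : ℤ) : ℚ) by norm_num]; exact not_isSquare_intCast_of_forall_mul_self_ne (ℓ := 17) (by decide))
      (by rw [show (177156100 : ℚ) * (2 * -13310 + 26840) = ((38974342000 : ℤ) : ℚ) by norm_num]; exact not_isSquare_intCast_of_forall_mul_self_ne (ℓ := 7) (by decide))

/-- **Torsion slots of `487200v2`, decided** (`#E(ℚ)[2^(j+1)] = 2`; Cremona `[2]`): cubic `4(x − e)(x² + Ax + B)`, `(e, A, B) = (8197, 8196, 9746604)`,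
`A² − 4B = 28188000` non-square ⇒ `#E(ℚ)[2] = 2`; `T = (8197, 0)` not halvable: `f′(e) = 144120025 = 12005²`, but `f′(e)·(3e + a₂ ± 2·12005) = 7004233215000, 83589614500` are not rational squares. [cite: SilvermanAEC2009, III.2.3 (d)] -/
theorem card_torsionBy_two_pow_succ_487200v2 (j : ℕ) :
    Nat.card (AddSubgroup.torsionBy (⟨0, -1, 0, -57436008, -79892912988⟩ : WeierstrassCurve ℚ).toAffine.Point ((2 ^ (j + 1) : ℕ) : ℤ)) = 2 ^ 1 := by
  haveI : (⟨0, -1, 0, -57436008, -79892912988⟩ : WeierstrassCurve ℚ).IsElliptic := ⟨by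
    rw [isUnit_iff_ne_zero]
    norm_num [WeierstrassCurve.Δ, WeierstrassCurve.b₂, WeierstrassCurve.b₄, WeierstrassCurve.b₆, WeierstrassCurve.b₈]⟩
  have hns : (⟨0, -1, 0, -57436008, -79892912988⟩ : WeierstrassCurve ℚ).toAffine.Nonsingular 8197 0 :=
    (WeierstrassCurve.Affine.equation_iff_nonsingular).mp (by rw [WeierstrassCurve.Affine.equation_iff]; norm_num)
  refine natCard_torsionBy_two_pow_succ_eq_two _ ?_ (Affine.Point.some_ne_zero hns) ?_ ?_ j
  · exact natCard_torsionBy_two_of_unique_root _ 8197 8196 9746604 (by rw [show (8196 : ℚ) ^ 2 - 4 * 9746604 = ((28188000 : ℤ) : ℚ) by norm_num]; exact not_isSquare_intCast_of_forall_mul_self_ne (ℓ := 17) (by decide))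
      (by intro x; norm_num [WeierstrassCurve.b₂, WeierstrassCurve.b₄, WeierstrassCurve.b₆]; ring)
  · rw [two_nsmul]; exact Affine.Point.add_self_of_Y_eq (by norm_num [WeierstrassCurve.Affine.negY])
  · exact no_halving_of_certificates _ rfl rfl (e := 8197) (t := 144120025) (α := 24590) (c := 12005) (by norm_num) (by norm_num)
      (by norm_num) (by rw [show (144120025 : ℚ) * (2 * 12005 + 24590) = ((7004233215000 : ℤ) : ℚ) by norm_num]; exact not_isSquare_intCast_of_forall_mul_self_ne (ℓ := 11) (by decide))
      (by rw [show (144120025 : ℚ) * (2 * -12005 + 24590) = ((83589614500 : ℤ) : ℚ) by norm_num]; exact not_isSquare_intCast_of_forall_mul_self_ne (ℓ := 11) (by decide))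

/-- **Torsion slots of `496320w4`, decided** (`#E(ℚ)[2^(j+1)] = 2`; Cremona `[2]`): cubic `4(x − e)(x² + Ax + B)`, `(e, A, B) = (8623, 8622, 28452465)`,
`A² − 4B = -39470976` non-square ⇒ `#E(ℚ)[2] = 2`; `T = (8623, 0)` not halvable: `f′(e) = 177156100 = 13310²`, but `f′(e)·(3e + a₂ ± 2·13310) = 9298569376800, -133221387200` are not rational squares. [cite: SilvermanAEC2009, III.2.3 (d)] -/
theorem card_torsionBy_two_pow_succ_496320w4 (j : ℕ) :
    Nat.card (AddSubgroup.torsionBy (⟨0, -1, 0, -45895041, -245345605695⟩ : WeierstrassCurve ℚ).toAffine.Point ((2 ^ (j + 1) : ℕ) : ℤ)) = 2 ^ 1 := by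
  haveI : (⟨0, -1, 0, -45895041, -245345605695⟩ : WeierstrassCurve ℚ).IsElliptic := ⟨by
    rw [isUnit_iff_ne_zero]
    norm_num [WeierstrassCurve.Δ, WeierstrassCurve.b₂, WeierstrassCurve.b₄, WeierstrassCurve.b₆, WeierstrassCurve.b₈]⟩
  have hns : (⟨0, -1, 0, -45895041, -245345605695⟩ : WeierstrassCurve ℚ).toAffine.Nonsingular 8623 0 :=
    (WeierstrassCurve.Affine.equation_iff_nonsingular).mp (by rw [WeierstrassCurve.Affine.equation_iff]; norm_num)
  refine natCard_torsionBy_two_pow_succ_eq_two _ ?_ (Affine.Point.some_ne_zero hns) ?_ ?_ j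
  · exact natCard_torsionBy_two_of_unique_root _ 8623 8622 28452465 (by intro h; have h' := h.nonneg; norm_num at h')
      (by intro x; norm_num [WeierstrassCurve.b₂, WeierstrassCurve.b₄, WeierstrassCurve.b₆]; ring)
  · rw [two_nsmul]; exact Affine.Point.add_self_of_Y_eq (by norm_num [WeierstrassCurve.Affine.negY])
  · exact no_halving_of_certificates _ rfl rfl (e := 8623) (t := 177156100) (α := 25868) (c := 13310) (by norm_num) (by norm_num)
      (by norm_num) (by rw [show (177156100 : ℚ) * (2 * 13310 + 25868) = ((9298569376800 : ℤ) : ℚ) by norm_num]; exact not_isSquare_intCast_of_forall_mul_self_ne (ℓ := 13) (by decide))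
      (by intro h; have h' := h.nonneg; norm_num at h')

/-- **Torsion slots of `120888c1`, decided** (`#E(ℚ)[2^(j+1)] = 2`; Cremona `[2]`): cubic `4(x − e)(x² + Ax + B)`, `(e, A, B) = (3419, 3419, 148807762)`,
`A² − 4B = -583541487` non-square ⇒ `#E(ℚ)[2] = 2`; `T = (3419, 0)` not halvable: `f′(e) = 172186884 = 13122²`, but `f′(e)·(3e + a₂ ± 2·13122) = 6284993452884, -2752751714508` are not rational squares. [cite: SilvermanAEC2009, III.2.3 (d)] -/
theorem card_torsionBy_two_pow_succ_120888c1 (j : ℕ) :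
    Nat.card (AddSubgroup.torsionBy (⟨0, 0, 0, 137118201, -508773738278⟩ : WeierstrassCurve ℚ).toAffine.Point ((2 ^ (j + 1) : ℕ) : ℤ)) = 2 ^ 1 := by
  haveI : (⟨0, 0, 0, 137118201, -508773738278⟩ : WeierstrassCurve ℚ).IsElliptic := ⟨by
    rw [isUnit_iff_ne_zero]
    norm_num [WeierstrassCurve.Δ, WeierstrassCurve.b₂, WeierstrassCurve.b₄, WeierstrassCurve.b₆, WeierstrassCurve.b₈]⟩
  have hns : (⟨0, 0, 0, 137118201, -508773738278⟩ : WeierstrassCurve ℚ).toAffine.Nonsingular 3419 0 :=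
    (WeierstrassCurve.Affine.equation_iff_nonsingular).mp (by rw [WeierstrassCurve.Affine.equation_iff]; norm_num)
  refine natCard_torsionBy_two_pow_succ_eq_two _ ?_ (Affine.Point.some_ne_zero hns) ?_ ?_ j
  · exact natCard_torsionBy_two_of_unique_root _ 3419 3419 148807762 (by intro h; have h' := h.nonneg; norm_num at h')
      (by intro x; norm_num [WeierstrassCurve.b₂, WeierstrassCurve.b₄, WeierstrassCurve.b₆]; ring)
  · rw [two_nsmul]; exact Affine.Point.add_self_of_Y_eq (by norm_num [WeierstrassCurve.Affine.negY])
  · exact no_halving_of_certificates _ rfl rfl (e := 3419) (t := 172186884) (α := 10257) (c := 13122) (by norm_num) (by norm_num)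
      (by norm_num) (by rw [show (172186884 : ℚ) * (2 * 13122 + 10257) = ((6284993452884 : ℤ) : ℚ) by norm_num]; exact not_isSquare_intCast_of_forall_mul_self_ne (ℓ := 7) (by decide))
      (by intro h; have h' := h.nonneg; norm_num at h')

/-- **Torsion slots of `275520o1`, decided** (`#E(ℚ)[2^(j+1)] = 2`; Cremona `[2]`): cubic `4(x − e)(x² + Ax + B)`, `(e, A, B) = (9375, 9374, 21996094)`,
`A² − 4B = -112500` non-square ⇒ `#E(ℚ)[2] = 2`; `T = (9375, 0)` not halvable: `f′(e) = 197767969 = 14063²`, but `f′(e)·(3e + a₂ ± 2·14063) = 11124448256250, -395535938` are not rational squares. [cite: SilvermanAEC2009, III.2.3 (d)] -/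
theorem card_torsionBy_two_pow_succ_275520o1 (j : ℕ) :
    Nat.card (AddSubgroup.torsionBy (⟨0, -1, 0, -65885156, -206213381250⟩ : WeierstrassCurve ℚ).toAffine.Point ((2 ^ (j + 1) : ℕ) : ℤ)) = 2 ^ 1 := by
  haveI : (⟨0, -1, 0, -65885156, -206213381250⟩ : WeierstrassCurve ℚ).IsElliptic := ⟨by
    rw [isUnit_iff_ne_zero]
    norm_num [WeierstrassCurve.Δ, WeierstrassCurve.b₂, WeierstrassCurve.b₄, WeierstrassCurve.b₆, WeierstrassCurve.b₈]⟩
  have hns : (⟨0, -1, 0, -65885156, -206213381250⟩ : WeierstrassCurve ℚ).toAffine.Nonsingular 9375 0 :=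
    (WeierstrassCurve.Affine.equation_iff_nonsingular).mp (by rw [WeierstrassCurve.Affine.equation_iff]; norm_num)
  refine natCard_torsionBy_two_pow_succ_eq_two _ ?_ (Affine.Point.some_ne_zero hns) ?_ ?_ j
  · exact natCard_torsionBy_two_of_unique_root _ 9375 9374 21996094 (by intro h; have h' := h.nonneg; norm_num at h')
      (by intro x; norm_num [WeierstrassCurve.b₂, WeierstrassCurve.b₄, WeierstrassCurve.b₆]; ring)
  · rw [two_nsmul]; exact Affine.Point.add_self_of_Y_eq (by norm_num [WeierstrassCurve.Affine.negY])
  · exact no_halving_of_certificates _ rfl rfl (e := 9375) (t := 197767969) (α := 28124) (c := 14063) (by norm_num) (by norm_num)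
      (by norm_num) (by rw [show (197767969 : ℚ) * (2 * 14063 + 28124) = ((11124448256250 : ℤ) : ℚ) by norm_num]; exact not_isSquare_intCast_of_forall_mul_self_ne (ℓ := 11) (by decide))
      (by intro h; have h' := h.nonneg; norm_num at h')

/-- **Torsion slots of `265200dr1`, decided** (`#E(ℚ)[2^(j+1)] = 2`; Cremona `[2]`): cubic `4(x − e)(x² + Ax + B)`, `(e, A, B) = (4672, 4671, 112599504)`,
`A² − 4B = -428579775` non-square ⇒ `#E(ℚ)[2] = 2`; `T = (4672, 0)` not halvable: `f′(e) = 156250000 = 12500²`, but `f′(e)·(3e + a₂ ± 2·12500) = 6096093750000, -1716406250000` are not rational squares. [cite: SilvermanAEC2009, III.2.3 (d)] -/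
theorem card_torsionBy_two_pow_succ_265200dr1 (j : ℕ) :
    Nat.card (AddSubgroup.torsionBy (⟨0, -1, 0, 90776592, -526064882688⟩ : WeierstrassCurve ℚ).toAffine.Point ((2 ^ (j + 1) : ℕ) : ℤ)) = 2 ^ 1 := by
  haveI : (⟨0, -1, 0, 90776592, -526064882688⟩ : WeierstrassCurve ℚ).IsElliptic := ⟨by
    rw [isUnit_iff_ne_zero]
    norm_num [WeierstrassCurve.Δ, WeierstrassCurve.b₂, WeierstrassCurve.b₄, WeierstrassCurve.b₆, WeierstrassCurve.b₈]⟩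
  have hns : (⟨0, -1, 0, 90776592, -526064882688⟩ : WeierstrassCurve ℚ).toAffine.Nonsingular 4672 0 :=
    (WeierstrassCurve.Affine.equation_iff_nonsingular).mp (by rw [WeierstrassCurve.Affine.equation_iff]; norm_num)
  refine natCard_torsionBy_two_pow_succ_eq_two _ ?_ (Affine.Point.some_ne_zero hns) ?_ ?_ j
  · exact natCard_torsionBy_two_of_unique_root _ 4672 4671 112599504 (by intro h; have h' := h.nonneg; norm_num at h')
      (by intro x; norm_num [WeierstrassCurve.b₂, WeierstrassCurve.b₄, WeierstrassCurve.b₆]; ring)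
  · rw [two_nsmul]; exact Affine.Point.add_self_of_Y_eq (by norm_num [WeierstrassCurve.Affine.negY])
  · exact no_halving_of_certificates _ rfl rfl (e := 4672) (t := 156250000) (α := 14015) (c := 12500) (by norm_num) (by norm_num)
      (by norm_num) (by rw [show (156250000 : ℚ) * (2 * 12500 + 14015) = ((6096093750000 : ℤ) : ℚ) by norm_num]; exact not_isSquare_intCast_of_forall_mul_self_ne (ℓ := 13) (by decide))
      (by intro h; have h' := h.nonneg; norm_num at h')

/-- **Torsion slots of `281456h1`, decided** (`#E(ℚ)[2^(j+1)] = 2`; Cremona `[2]`): cubic `4(x − e)(x² + Ax + B)`, `(e, A, B) = (-819, -819, -1340738)`,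
`A² − 4B = 6033713` non-square ⇒ `#E(ℚ)[2] = 2`; `T = (-819, 0)` not halvable: `f′(e) = 784 = 28²`, but `f′(e)·(3e + a₂ ± 2·28) = -1882384, -1970192` are not rational squares. [cite: SilvermanAEC2009, III.2.3 (d)] -/
theorem card_torsionBy_two_pow_succ_281456h1 (j : ℕ) :
    Nat.card (AddSubgroup.torsionBy (⟨0, 0, 0, -2011499, -1098064422⟩ : WeierstrassCurve ℚ).toAffine.Point ((2 ^ (j + 1) : ℕ) : ℤ)) = 2 ^ 1 := by
  haveI : (⟨0, 0, 0, -2011499, -1098064422⟩ : WeierstrassCurve ℚ).IsElliptic := ⟨by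
    rw [isUnit_iff_ne_zero]
    norm_num [WeierstrassCurve.Δ, WeierstrassCurve.b₂, WeierstrassCurve.b₄, WeierstrassCurve.b₆, WeierstrassCurve.b₈]⟩
  have hns : (⟨0, 0, 0, -2011499, -1098064422⟩ : WeierstrassCurve ℚ).toAffine.Nonsingular (-819) 0 :=
    (WeierstrassCurve.Affine.equation_iff_nonsingular).mp (by rw [WeierstrassCurve.Affine.equation_iff]; norm_num)
  refine natCard_torsionBy_two_pow_succ_eq_two _ ?_ (Affine.Point.some_ne_zero hns) ?_ ?_ j
  · exact natCard_torsionBy_two_of_unique_root _ (-819) (-819) (-1340738) (by rw [show ((-819) : ℚ) ^ 2 - 4 * (-1340738) = ((6033713 : ℤ) : ℚ) by norm_num]; exact not_isSquare_intCast_of_forall_mul_self_ne (ℓ := 3) (by decide))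
      (by intro x; norm_num [WeierstrassCurve.b₂, WeierstrassCurve.b₄, WeierstrassCurve.b₆]; ring)
  · rw [two_nsmul]; exact Affine.Point.add_self_of_Y_eq (by norm_num [WeierstrassCurve.Affine.negY])
  · exact no_halving_of_certificates _ rfl rfl (e := (-819)) (t := 784) (α := (-2457)) (c := 28) (by norm_num) (by norm_num)
      (by norm_num) (by intro h; have h' := h.nonneg; norm_num at h')
      (by intro h; have h' := h.nonneg; norm_num at h')

/-! ## §2 The plug-in, once: the torsion hypotheses of a landed stamp discharged by name -/

/-- **`missingUpperBoundAt_two_31200bc1_of_31200bc3` WITHOUT its torsion hypotheses** (p662759, `…ReducibleRestSiblingInstancesA`):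
`ht`, `ht₁`, `ht₂` are `card_torsionBy_two_pow_succ_31200bc3 0 / 1 / 2`; what remains displayed is `hCT`, `hCassels`, `hGZK`, `hmod`,
the record `hr`, the three Selmer counts at `31200bc3` and `#Ш_an(31200bc3) = q'` with `4 ≤ ord₂ q'`. The same substitution applies
verbatim to the other ten stamps. [cite: SilvermanAEC2009, Thm. X.4.2 and Thm. X.4.14] [cite: Miller2011LMS, Def. 1.1] -/
theorem missingUpperBoundAt_two_31200bc1_of_31200bc3_selmerOnly (hCT : exists_casselsTate_pairing (K := ℚ))
    (hCassels : bsdRHS_eq_of_isIsogenous) (hGZK : rank_eq_analyticRank_of_analyticRank_le_one) (hmod : hasEntireLFunction_rat)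
    (hr : haveI := isElliptic_31200bc1; (⟨0, -1, 0, -40041158, -97503029688⟩ : WeierstrassCurve ℚ).analyticRank = 0)
    (hs : Nat.card ((⟨0, -1, 0, -42787408, -83359842188⟩ : WeierstrassCurve ℚ).selmerGroup 2) = 2 ^ 3)
    (hs₁ : Nat.card ((⟨0, -1, 0, -42787408, -83359842188⟩ : WeierstrassCurve ℚ).selmerGroup (2 ^ 2)) = 2 ^ 5)
    (hs₂ : Nat.card ((⟨0, -1, 0, -42787408, -83359842188⟩ : WeierstrassCurve ℚ).selmerGroup (2 ^ (2 + 1))) = 2 ^ 5)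
    {q' : ℚ} (hq' : haveI := isElliptic_31200bc3; shaAn (⟨0, -1, 0, -42787408, -83359842188⟩ : WeierstrassCurve ℚ) = (q' : ℂ))
    (hv' : 4 ≤ padicValRat 2 q') :
    haveI := isElliptic_31200bc1
    MissingUpperBoundAt (⟨0, -1, 0, -40041158, -97503029688⟩ : WeierstrassCurve ℚ) 2 :=
  missingUpperBoundAt_two_31200bc1_of_31200bc3 hCT hCassels hGZK hmod hr hs (card_torsionBy_two_pow_succ_31200bc3 0) hs₁
    (card_torsionBy_two_pow_succ_31200bc3 1) hs₂ (card_torsionBy_two_pow_succ_31200bc3 2) hq' hv'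

end Summit.BirchSwinnertonDyer.BirchSwinnertonDyer.Theorems.AddPotGoodInstances

end
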